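import Mathlib

/-!
# AtomicCalibrationR (stmt-QuantumFields-28169), E2 `stub_offDiagonalWhitney` — the product grid partition of unity
# (Plan A step 3 of planner ym-idea-11 g15's `STUB-PLAN-offDiagonalWhitney.md`; prover w4 g22, free hands)

For a one-dimensional profile `φ` (think: the periodic partition of unity of `AtomicCalibrationRPeriodicPartition`,
`supp φ ⊆ [-1,1]`, `Σ_{c ∈ ℤ} φ(t − c) = 1`), a mesh `h > 0` and an integer multi-index `c : Fin n × Fin 4 → ℤ`, the
**grid bump** `gridBump φ n h c : (Fin n → ℝ⁴) → ℝ`, `z ↦ ∏_q φ(z_q / h − c_q)`.  This file proves the bookkeeping every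
Whitney-type construction from these bumps needs:

* `contDiff_gridBump`, `gridBump_nonneg`;
* support: `abs_sub_le_of_gridBump_ne_zero` (`|z_q − h c_q| ≤ h`), `norm_sub_gridCentre_le_of_gridBump_ne_zero`
  (`‖z_l − centre_l‖ ≤ 2h` slotwise, the shape of the `tsupport` clause of `WhitneyPkg`), `tsupport_gridBump_subset`,
  `hasCompactSupport_gridBump`;
* partition of unity: `gridBump_eq_zero_of_not_mem_gridBox`, `sum_gridBox_gridBump_eq_one`, `hasSum_gridBump_one`,
  `tsum_gridBump_eq_one` (from the one-dimensional identity via `Finset.prod_univ_sum`);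
* `norm_iteratedFDeriv_prod_le_sum_pow` — the Leibniz–multinomial bound with per-factor rates
  (`‖D^j f_i‖ ≤ M_i^j ⇒ ‖D^m ∏ f_i‖ ≤ (Σ_i M_i)^m`), the form needed for products of bumps of different meshes.

Mathlib only; no stub/crux/rung/summit is closed; nothing here touches Yang–Mills; the YM mass gap is NOT proved. [folklore]
-/

set_option autoImplicit false

noncomputable section

open scoped BigOperators ContDiff
open Set

namespace Summit.QuantumFields.YangMills.Cruxes.AtomicCalibrationR.GridPartition

/-! ## The grid bump and its centre -/

/-- The product grid bump of mesh `h` at the integer multi-index `c`: `z ↦ ∏_q φ(z_q / h − c_q)`,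
`q = (l, i) ∈ Fin n × Fin 4`. -/
def gridBump (φ : ℝ → ℝ) (n : ℕ) (h : ℝ) (c : Fin n × Fin 4 → ℤ) (z : Fin n → EuclideanSpace ℝ (Fin 4)) : ℝ :=
  ∏ q : Fin n × Fin 4, φ (z q.1 q.2 / h - c q)

/-- The centre of the grid cube `(h, c)` in slot `l`: the point `h • c_{l,·}` of `ℝ⁴`. -/
def gridCentre (n : ℕ) (h : ℝ) (c : Fin n × Fin 4 → ℤ) (l : Fin n) : EuclideanSpace ℝ (Fin 4) :=
  WithLp.toLp 2 fun i => h * (c (l, i) : ℝ)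

/-- Coordinates of the centre. -/
@[simp] theorem gridCentre_apply (n : ℕ) (h : ℝ) (c : Fin n × Fin 4 → ℤ) (l : Fin n) (i : Fin 4) :
    gridCentre n h c l i = h * (c (l, i) : ℝ) := rfl

/-- Grid bumps are `C^∞` when the profile is. -/
theorem contDiff_gridBump {φ : ℝ → ℝ} (hφ : ContDiff ℝ ∞ φ) (n : ℕ) (h : ℝ) (c : Fin n × Fin 4 → ℤ) :
    ContDiff ℝ ∞ (gridBump φ n h c) := by
  unfold gridBump
  refine contDiff_prod fun q _ => ?_
  have hcoord : ContDiff ℝ ∞ (fun z : Fin n → EuclideanSpace ℝ (Fin 4) => z q.1 q.2) :=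
    ((EuclideanSpace.proj q.2 : EuclideanSpace ℝ (Fin 4) →L[ℝ] ℝ).comp
      (ContinuousLinearMap.proj q.1 : (Fin n → EuclideanSpace ℝ (Fin 4)) →L[ℝ] EuclideanSpace ℝ (Fin 4))).contDiff
  have h2 : ContDiff ℝ ∞ (fun z : Fin n → EuclideanSpace ℝ (Fin 4) => z q.1 q.2 / h - (c q : ℝ)) :=
    (hcoord.div_const h).sub contDiff_const
  exact hφ.comp h2

/-- Grid bumps are non-negative when the profile is. -/
theorem gridBump_nonneg {φ : ℝ → ℝ} (hφ0 : ∀ t, 0 ≤ φ t) (n : ℕ) (h : ℝ) (c : Fin n × Fin 4 → ℤ)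
    (z : Fin n → EuclideanSpace ℝ (Fin 4)) : 0 ≤ gridBump φ n h c z :=
  Finset.prod_nonneg fun _ _ => hφ0 _

/-! ## Support -/

/-- Outside `[-1, 1]` the profile vanishes. -/
theorem profile_eq_zero {φ : ℝ → ℝ} (hφs : tsupport φ ⊆ Icc (-1 : ℝ) 1) {t : ℝ} (ht : 1 < |t|) : φ t = 0 := by
  by_contra hne
  have hmem : t ∈ Icc (-1 : ℝ) 1 := hφs (subset_tsupport φ (Function.mem_support.2 hne))
  have := abs_le.2 ⟨by linarith [hmem.1], hmem.2⟩
  linarith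

/-- On the support of a grid bump every coordinate is within `h` of the corresponding centre coordinate. -/
theorem abs_sub_le_of_gridBump_ne_zero {φ : ℝ → ℝ} (hφs : tsupport φ ⊆ Icc (-1 : ℝ) 1) {n : ℕ} {h : ℝ}
    (hh : 0 < h) {c : Fin n × Fin 4 → ℤ} {z : Fin n → EuclideanSpace ℝ (Fin 4)} (hz : gridBump φ n h c z ≠ 0)
    (q : Fin n × Fin 4) : |z q.1 q.2 - h * (c q : ℝ)| ≤ h := by
  have hq : φ (z q.1 q.2 / h - c q) ≠ 0 := by
    intro h0
    exact hz (Finset.prod_eq_zero (Finset.mem_univ q) h0)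
  have hle : |z q.1 q.2 / h - c q| ≤ 1 := by
    by_contra hlt
    exact hq (profile_eq_zero hφs (not_le.1 hlt))
  have heq : z q.1 q.2 - h * (c q : ℝ) = h * (z q.1 q.2 / h - c q) := by
    field_simp
  rw [heq, abs_mul, abs_of_pos hh]
  exact mul_le_of_le_one_right hh.le hle

/-- On the support of a grid bump every slot is within `2h` (Euclidean norm on `ℝ⁴`) of the slot centre. -/
theorem norm_sub_gridCentre_le_of_gridBump_ne_zero {φ : ℝ → ℝ} (hφs : tsupport φ ⊆ Icc (-1 : ℝ) 1) {n : ℕ}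
    {h : ℝ} (hh : 0 < h) {c : Fin n × Fin 4 → ℤ} {z : Fin n → EuclideanSpace ℝ (Fin 4)}
    (hz : gridBump φ n h c z ≠ 0) (l : Fin n) : ‖z l - gridCentre n h c l‖ ≤ 2 * h := by
  have hcoord : ∀ i : Fin 4, |(z l - gridCentre n h c l) i| ≤ h := by
    intro i
    have := abs_sub_le_of_gridBump_ne_zero hφs hh hz (l, i)
    simpa [gridCentre] using this
  rw [EuclideanSpace.norm_eq]
  have hsum : ∑ i : Fin 4, ‖(z l - gridCentre n h c l) i‖ ^ 2 ≤ (2 * h) ^ 2 := by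
    calc ∑ i : Fin 4, ‖(z l - gridCentre n h c l) i‖ ^ 2 ≤ ∑ _i : Fin 4, h ^ 2 :=
          Finset.sum_le_sum fun i _ => by
            rw [Real.norm_eq_abs]
            exact pow_le_pow_left₀ (abs_nonneg _) (hcoord i) 2
      _ = (2 * h) ^ 2 := by simp; ring
  calc Real.sqrt (∑ i : Fin 4, ‖(z l - gridCentre n h c l) i‖ ^ 2) ≤ Real.sqrt ((2 * h) ^ 2) :=
        Real.sqrt_le_sqrt hsum
    _ = 2 * h := Real.sqrt_sq (by linarith)

/-- The `tsupport` clause of `WhitneyPkg` for grid bumps: `tsupport ⊆ {z | ∀ l, ‖z_l − centre_l‖ ≤ 2h}`. -/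
theorem tsupport_gridBump_subset {φ : ℝ → ℝ} (hφs : tsupport φ ⊆ Icc (-1 : ℝ) 1) (n : ℕ) {h : ℝ} (hh : 0 < h)
    (c : Fin n × Fin 4 → ℤ) :
    tsupport (gridBump φ n h c) ⊆ {z | ∀ l, ‖z l - gridCentre n h c l‖ ≤ 2 * h} := by
  refine closure_minimal (fun z hz l => norm_sub_gridCentre_le_of_gridBump_ne_zero hφs hh hz l) ?_
  have : {z : Fin n → EuclideanSpace ℝ (Fin 4) | ∀ l, ‖z l - gridCentre n h c l‖ ≤ 2 * h} =
      ⋂ l, {z | ‖z l - gridCentre n h c l‖ ≤ 2 * h} := by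
    ext z; simp
  rw [this]
  exact isClosed_iInter fun l => isClosed_le (by fun_prop) continuous_const

/-- The support box is the closed ball of radius `2h` around the centre (sup norm over slots). -/
theorem tsupport_gridBump_subset_closedBall {φ : ℝ → ℝ} (hφs : tsupport φ ⊆ Icc (-1 : ℝ) 1) (n : ℕ) {h : ℝ}
    (hh : 0 < h) (c : Fin n × Fin 4 → ℤ) :
    tsupport (gridBump φ n h c) ⊆ Metric.closedBall (gridCentre n h c) (2 * h) := by
  intro z hz
  rw [Metric.mem_closedBall, dist_eq_norm]
  exact (pi_norm_le_iff_of_nonneg (by linarith)).2 fun l => tsupport_gridBump_subset hφs n hh c hz l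

/-- Grid bumps have compact support. -/
theorem hasCompactSupport_gridBump {φ : ℝ → ℝ} (hφs : tsupport φ ⊆ Icc (-1 : ℝ) 1) (n : ℕ) {h : ℝ}
    (hh : 0 < h) (c : Fin n × Fin 4 → ℤ) : HasCompactSupport (gridBump φ n h c) :=
  IsCompact.of_isClosed_subset (isCompact_closedBall _ _) (isClosed_tsupport _)
    (tsupport_gridBump_subset_closedBall hφs n hh c)

/-! ## Partition of unity -/

/-- The finite box of multi-indices whose bump can be non-zero at `z`. -/
def gridBox (n : ℕ) (h : ℝ) (z : Fin n → EuclideanSpace ℝ (Fin 4)) : Finset (Fin n × Fin 4 → ℤ) :=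
  Fintype.piFinset fun q : Fin n × Fin 4 => Finset.Icc (⌊z q.1 q.2 / h⌋ - 1) (⌈z q.1 q.2 / h⌉ + 1)

/-- One-dimensional localisation: `φ(t − j) = 0` unless `j ∈ [⌊t⌋ − 1, ⌈t⌉ + 1]`. -/
theorem profile_sub_eq_zero {φ : ℝ → ℝ} (hφs : tsupport φ ⊆ Icc (-1 : ℝ) 1) (t : ℝ) {j : ℤ}
    (hj : j ∉ Finset.Icc (⌊t⌋ - 1) (⌈t⌉ + 1)) : φ (t - j) = 0 := by
  refine profile_eq_zero hφs ?_
  rw [Finset.mem_Icc, not_and_or, not_le, not_le] at hj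
  rcases hj with hj | hj
  · -- `j < ⌊t⌋ - 1`, so `t - j > 1`
    have hj' : (j : ℝ) + 1 ≤ (⌊t⌋ : ℤ) - 1 := by exact_mod_cast hj
    have hfl : ((⌊t⌋ : ℤ) : ℝ) ≤ t := Int.floor_le t
    rw [lt_abs]; left; linarith
  · -- `⌈t⌉ + 1 < j`, so `t - j < -1`
    have hj' : ((⌈t⌉ : ℤ) : ℝ) + 1 + 1 ≤ j := by exact_mod_cast hj
    have hce : t ≤ ((⌈t⌉ : ℤ) : ℝ) := Int.le_ceil t
    rw [lt_abs]; right; linarith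

/-- Outside the box the bump vanishes at `z`. -/
theorem gridBump_eq_zero_of_not_mem_gridBox {φ : ℝ → ℝ} (hφs : tsupport φ ⊆ Icc (-1 : ℝ) 1) (n : ℕ) (h : ℝ)
    {c : Fin n × Fin 4 → ℤ} {z : Fin n → EuclideanSpace ℝ (Fin 4)} (hc : c ∉ gridBox n h z) :
    gridBump φ n h c z = 0 := by
  unfold gridBox at hc
  rw [Fintype.mem_piFinset, not_forall] at hc
  obtain ⟨q, hq⟩ := hc
  exact Finset.prod_eq_zero (Finset.mem_univ q) (profile_sub_eq_zero hφs _ hq)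

/-- One-dimensional partition of unity as a finite sum over the localisation window. -/
theorem sum_Icc_profile_eq_one {φ : ℝ → ℝ} (hφs : tsupport φ ⊆ Icc (-1 : ℝ) 1)
    (hφ1 : ∀ t, ∑' j : ℤ, φ (t - j) = 1) (t : ℝ) :
    ∑ j ∈ Finset.Icc (⌊t⌋ - 1) (⌈t⌉ + 1), φ (t - j) = 1 := by
  have hs : HasSum (fun j : ℤ => φ (t - j)) (∑ j ∈ Finset.Icc (⌊t⌋ - 1) (⌈t⌉ + 1), φ (t - j)) :=
    hasSum_sum_of_ne_finset_zero fun j hj => profile_sub_eq_zero hφs t hj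
  rw [← hs.tsum_eq, hφ1 t]

/-- **Partition of unity, finite form**: `Σ_{c ∈ box(z)} gridBump c z = 1`. -/
theorem sum_gridBox_gridBump_eq_one {φ : ℝ → ℝ} (hφs : tsupport φ ⊆ Icc (-1 : ℝ) 1)
    (hφ1 : ∀ t, ∑' j : ℤ, φ (t - j) = 1) (n : ℕ) (h : ℝ) (z : Fin n → EuclideanSpace ℝ (Fin 4)) :
    ∑ c ∈ gridBox n h z, gridBump φ n h c z = 1 := by
  unfold gridBox gridBump
  rw [← Finset.prod_univ_sum (fun q : Fin n × Fin 4 => Finset.Icc (⌊z q.1 q.2 / h⌋ - 1) (⌈z q.1 q.2 / h⌉ + 1))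
    (fun q j => φ (z q.1 q.2 / h - j))]
  exact Finset.prod_eq_one fun q _ => sum_Icc_profile_eq_one hφs hφ1 _

/-- **Partition of unity**: `HasSum (c ↦ gridBump c z) 1`. -/
theorem hasSum_gridBump_one {φ : ℝ → ℝ} (hφs : tsupport φ ⊆ Icc (-1 : ℝ) 1)
    (hφ1 : ∀ t, ∑' j : ℤ, φ (t - j) = 1) (n : ℕ) (h : ℝ) (z : Fin n → EuclideanSpace ℝ (Fin 4)) :
    HasSum (fun c : Fin n × Fin 4 → ℤ => gridBump φ n h c z) 1 := by
  rw [← sum_gridBox_gridBump_eq_one hφs hφ1 n h z]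
  exact hasSum_sum_of_ne_finset_zero fun c hc => gridBump_eq_zero_of_not_mem_gridBox hφs n h hc

/-- **Partition of unity**: `Σ' c, gridBump c z = 1`. -/
theorem tsum_gridBump_eq_one {φ : ℝ → ℝ} (hφs : tsupport φ ⊆ Icc (-1 : ℝ) 1)
    (hφ1 : ∀ t, ∑' j : ℤ, φ (t - j) = 1) (n : ℕ) (h : ℝ) (z : Fin n → EuclideanSpace ℝ (Fin 4)) :
    ∑' c : Fin n × Fin 4 → ℤ, gridBump φ n h c z = 1 :=
  (hasSum_gridBump_one hφs hφ1 n h z).tsum_eq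

/-- Bounded overlap: at most `4^{4n}` bumps of a fixed mesh are non-zero at any point (the box has `≤ 4` integers per coordinate). -/
theorem card_gridBox_le (n : ℕ) (h : ℝ) (z : Fin n → EuclideanSpace ℝ (Fin 4)) :
    (gridBox n h z).card ≤ 4 ^ (4 * n) := by
  unfold gridBox
  rw [Fintype.card_piFinset]
  calc ∏ q : Fin n × Fin 4, (Finset.Icc (⌊z q.1 q.2 / h⌋ - 1) (⌈z q.1 q.2 / h⌉ + 1)).card
      ≤ ∏ _q : Fin n × Fin 4, 4 := by
        refine Finset.prod_le_prod' fun q _ => ?_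
        rw [Int.card_Icc]
        have := Int.ceil_le_floor_add_one (z q.1 q.2 / h)
        omega
    _ = 4 ^ (4 * n) := by
        rw [Finset.prod_const, Finset.card_univ, Fintype.card_prod, Fintype.card_fin, Fintype.card_fin, mul_comm]

/-! ## The Leibniz–multinomial bound with per-factor rates -/

variable {E : Type} [NormedAddCommGroup E] [NormedSpace ℝ E]

/-- **Leibniz–multinomial bound, per-factor rates.**  If the factors of a finite product of real `C^∞` functions satisfy
`‖D^j f_i(x)‖ ≤ M_i^j` for `j ≤ m`, then `‖D^m (∏_{i ∈ u} f_i)(x)‖ ≤ (Σ_{i ∈ u} M_i)^m` — the multinomial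
theorem `Finset.sum_pow` on top of Mathlib's `norm_iteratedFDeriv_prod_le`.  (Products of bumps of geometric meshes
`h_0 > h_1 > ⋯ > h_k` thus have `‖D^m‖ ≤ (Σ_j A/h_j)^m ≤ (2A/h_k)^m`, with no `k^m` loss.) [folklore] -/
theorem norm_iteratedFDeriv_prod_le_sum_pow {ι : Type*} [DecidableEq ι] (u : Finset ι) (f : ι → E → ℝ)
    (hf : ∀ i ∈ u, ContDiff ℝ ∞ (f i)) (M : ι → ℝ) (m : ℕ) (x : E)
    (hb : ∀ i ∈ u, ∀ j : ℕ, j ≤ m → ‖iteratedFDeriv ℝ j (f i) x‖ ≤ M i ^ j) :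
    ‖iteratedFDeriv ℝ m (fun x => ∏ i ∈ u, f i x) x‖ ≤ (∑ i ∈ u, M i) ^ m := by
  have h1 := norm_iteratedFDeriv_prod_le (𝕜 := ℝ) (u := u) (f := f) (N := (⊤ : ℕ∞)) (x := x) (n := m)
    (fun i hi => hf i hi) (by exact_mod_cast le_top)
  refine h1.trans ?_
  have hterm : ∀ p ∈ u.sym m, ((p : Multiset ι).countPerms : ℝ) *
      ∏ j ∈ u, ‖iteratedFDeriv ℝ ((p : Multiset ι).count j) (f j) x‖ ≤
        ((p : Multiset ι).countPerms : ℝ) * ((p : Multiset ι).map M).prod := by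
    intro p hp
    refine mul_le_mul_of_nonneg_left ?_ (Nat.cast_nonneg _)
    have hps : ∀ a ∈ (p : Multiset ι), a ∈ u := Finset.mem_sym_iff.1 hp
    have hcount : ∀ j ∈ u, (p : Multiset ι).count j ≤ m := fun j _ =>
      (Multiset.count_le_card j _).trans (le_of_eq (Sym.card_coe))
    have hsub : (p : Multiset ι).toFinset ⊆ u := fun a ha => hps a (Multiset.mem_toFinset.1 ha)
    calc ∏ j ∈ u, ‖iteratedFDeriv ℝ ((p : Multiset ι).count j) (f j) x‖
        ≤ ∏ j ∈ u, M j ^ (p : Multiset ι).count j :=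
          Finset.prod_le_prod (fun j _ => norm_nonneg _) fun j hj => hb j hj _ (hcount j hj)
      _ = ((p : Multiset ι).map M).prod := by
          rw [Finset.prod_multiset_map_count]
          refine (Finset.prod_subset hsub fun j _ hj => ?_).symm
          rw [Multiset.mem_toFinset, ← Multiset.count_eq_zero] at hj
          rw [hj, pow_zero]
  calc ∑ p ∈ u.sym m, ((p : Multiset ι).countPerms : ℝ) * ∏ j ∈ u, ‖iteratedFDeriv ℝ ((p : Multiset ι).count j) (f j) x‖
      ≤ ∑ p ∈ u.sym m, ((p : Multiset ι).countPerms : ℝ) * ((p : Multiset ι).map M).prod := Finset.sum_le_sum hterm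
    _ = (∑ i ∈ u, M i) ^ m := (Finset.sum_pow M m).symm

end Summit.QuantumFields.YangMills.Cruxes.AtomicCalibrationR.GridPartition

end
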